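import Summits.CriticalPhenomena.PercolationContinuityZ3.Theorems.PercNearOneGluingNoHeavyLowerTailQuantitativeBHKMajorant
import Literature.Probability.LatticeModels.ProdBernoulliAtomExpansion
import HarnessLib

/-!
# The separation floor: quantitative BHK Thm 1.3 for connection events

Support file (`--supports stmt-CriticalPhenomena-4575`), prover seat `prim-rate-mine-2` (lane prim-rate, constants-miner (c), BENCH row
M2-R10, connection form; `run/shared/lean/prim/prim-rate/prim-rate-mine-2/CANDIDATES.md` §gen-2, PROOFS.md §P6–P7).  No definitions,
no named facts, no sorries; standard axioms.

For weights supported on a pair set `E`, `D = {s ↮ X}` and vertices `a, b`: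

  `μ(D ∩ {s↔a})·μ(D ∩ Sep) ≤ μ(D)·μ(D ∩ {s↔a} ∩ {s↔b}) − μ(D ∩ {s↔a})·μ(D ∩ {s↔b})`,

`Sep = {b ∉ C_s, and no vertex of C_s is joined to a by pairs of E avoiding X ∪ {b}}` («b separates C_s from a off X»), i.e.
`Cov(1{s↔a}, 1{s↔b} | s↮X) ≥ ν(s↔a)·ν(Sep)`: an explicit, vertex-separation lower bound for van den Berg–Häggström–Kahn's conditional
positive association (their Thm 1.3 gives the sign), exact on series configurations, and at `X = ∅` a Harris floor of a new shape (no
size constant; positive exactly on the AND/series structure where joint pivotality vanishes).  Proof = the abstract majorant floor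
`QuantBHK.condCov_ge_majorant_gap` with the lifted cluster `R(W) = openCluster (W ∩ E) s`, the increasing majorant
`1{b ∈ R ∨ R meets X ∨ Sep(R)}` (increasing by a walk-transfer argument), and the a.s. identification `R(C_s^edge) = C_s`.
[cite: VandenbergHaggstromKahn2005, Thm. 1.3 (p. 6)]
-/

noncomputable section

namespace Summit.CriticalPhenomena.PercolationContinuityZ3.Theorems

open MeasureTheory Set Literature.Probability.LatticeModels Literature.Probability.Percolation
open scoped Classical

namespace QuantBHK

universe v

variable {V : Type v} [Fintype V]

/-! ### Combinatorics: pairs avoiding a vertex set, separation, and the lifted cluster -/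

omit [Fintype V] in
/-- `b` separates the vertex set `C` from `a` in the support graph `E` off `X`: no vertex of `C` is joined to `a` by a path of
pairs of `E` avoiding `X ∪ {b}`. [folklore] -/
theorem reachable_avoid_of_walk {E W : Set (Sym2 V)} {S : Set V} {s u : V}
    (hR : ∀ v ∈ openCluster (W ∩ E) s, v ∉ S) (h : (openGraph (W ∩ E)).Reachable s u) :
    (openGraph {e | e ∈ E ∧ ∀ v ∈ e, v ∉ S}).Reachable s u := by
  obtain ⟨p⟩ := h
  refine ⟨p.transfer (openGraph {e | e ∈ E ∧ ∀ v ∈ e, v ∉ S}) fun e he => ?_⟩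
  have he' := p.edges_subset_edgeSet he
  rw [openGraph, SimpleGraph.edgeSet_fromEdgeSet] at he'
  rw [openGraph, SimpleGraph.edgeSet_fromEdgeSet]
  refine ⟨⟨he'.1.2, fun v hv => hR v ?_⟩, he'.2⟩
  exact (p.takeUntil v (SimpleGraph.Walk.mem_support_of_mem_edges he hv)).reachable

omit [Fintype V] in
/-- Reachability from `s` inside the open edge cluster of `s` is reachability from `s`. [folklore] -/
theorem openCluster_openEdgeCluster (ω : BondConfig V) (s : V) :
    openCluster (openEdgeCluster ω s) s = openCluster ω s := by
  refine Set.Subset.antisymm (openCluster_mono (openEdgeCluster_subset ω s) s) fun y hy => ?_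
  obtain ⟨p⟩ := (hy : (openGraph ω).Reachable s y)
  refine ⟨p.transfer (openGraph (openEdgeCluster ω s)) fun e he => ?_⟩
  have he' := p.edges_subset_edgeSet he
  rw [openGraph, SimpleGraph.edgeSet_fromEdgeSet] at he'
  rw [openGraph, SimpleGraph.edgeSet_fromEdgeSet]
  refine ⟨⟨he'.1, he'.2, fun v hv => ?_⟩, he'.2⟩
  exact (p.takeUntil v (SimpleGraph.Walk.mem_support_of_mem_edges he hv)).reachable

/-! ### The separation floor for connection events -/

/-- **Separation floor (quantitative BHK Thm 1.3 for connection events).**  Weights supported on the pair set `E` (`w e = 0` off `E`),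
`D = {s ↮ X}`, `C_s = openCluster ω s`, `a, b` any vertices.  With the separation event
`Sep = {b ∉ C_s and no vertex of C_s is joined to a by a path of pairs of E avoiding X ∪ {b}}` (on `D ∩ Sep` also `a ∉ C_s`):
  `μ(D ∩ {s↔a}) · μ(D ∩ Sep) ≤ μ(D)·μ(D ∩ {s↔a} ∩ {s↔b}) − μ(D ∩ {s↔a})·μ(D ∩ {s↔b})`,
i.e. `Cov(1{s↔a}, 1{s↔b} | s ↮ X) ≥ ν(s↔a)·ν(Sep)` — the BENCH row M2-R10 (connection form) of the prim-rate lane.  Proof: the abstract majorant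
floor `condCov_ge_majorant_gap` with `F = 1{a ∈ R}`, `G = 1{b ∈ R ∨ R meets X}`, `G̃ = 1{b ∈ R ∨ R meets X ∨ Sep(R)}` on edge sets,
`R(W) = openCluster (W ∩ E) s` (`G̃` is increasing by `reachable_avoid_of_walk`), and the a.s. identification `R(C_s^{edge}) = C_s`
(pairs off `E` are a.s. closed). [cite: VandenbergHaggstromKahn2005, Thm. 1.3 (p. 6)] -/
theorem condCov_openConn_ge_separation (w : Sym2 V → unitInterval) (E : Set (Sym2 V)) (hE : ∀ e, e ∉ E → (w e : ℝ) = 0)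
    (s : V) (X : Set V) (hs : s ∉ X) (a b : V) :
    (prodBernoulli w).real ({ω : BondConfig V | ∀ x ∈ X, ¬ (openGraph ω).Reachable s x} ∩ openConn s a) *
      (prodBernoulli w).real ({ω : BondConfig V | ∀ x ∈ X, ¬ (openGraph ω).Reachable s x} ∩
        {ω | b ∉ openCluster ω s ∧ ∀ u ∈ openCluster ω s, ¬ (openGraph ({e | e ∈ E ∧ ∀ v ∈ e, v ∉ X ∪ {b}})).Reachable u a}) ≤
    (prodBernoulli w).real {ω : BondConfig V | ∀ x ∈ X, ¬ (openGraph ω).Reachable s x} *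
        (prodBernoulli w).real ({ω : BondConfig V | ∀ x ∈ X, ¬ (openGraph ω).Reachable s x} ∩ openConn s a ∩ openConn s b) -
      (prodBernoulli w).real ({ω : BondConfig V | ∀ x ∈ X, ¬ (openGraph ω).Reachable s x} ∩ openConn s a) *
        (prodBernoulli w).real ({ω : BondConfig V | ∀ x ∈ X, ¬ (openGraph ω).Reachable s x} ∩ openConn s b) := by
  set μ := prodBernoulli w with hμ
  set D : Set (BondConfig V) := {ω : BondConfig V | ∀ x ∈ X, ¬ (openGraph ω).Reachable s x} with hD
  have hmeas : ∀ S : Set (BondConfig V), MeasurableSet S := fun _ => MeasurableSet.of_discrete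
  -- the lifted cluster and the three functionals on edge sets
  set R : Set (Sym2 V) → Set V := fun W => openCluster (W ∩ E) s with hR
  set sep : Set V → Prop := fun C => ∀ u ∈ C, ¬ (openGraph ({e | e ∈ E ∧ ∀ v ∈ e, v ∉ X ∪ {b}})).Reachable u a with hsep
  set F : Set (Sym2 V) → ℝ := fun W => if a ∈ R W then 1 else 0 with hF
  set G : Set (Sym2 V) → ℝ := fun W => if (b ∈ R W ∨ ∃ x ∈ X, x ∈ R W) then 1 else 0 with hG
  set Gt : Set (Sym2 V) → ℝ := fun W => if (b ∈ R W ∨ (∃ x ∈ X, x ∈ R W) ∨ sep (R W)) then 1 else 0 with hGt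
  have hRmono : ∀ W W' : Set (Sym2 V), W ⊆ W' → R W ⊆ R W' := fun W W' h =>
    openCluster_mono (Set.inter_subset_inter_left E h) s
  have hFmono : Monotone F := by
    intro W W' h
    simp only [hF]
    by_cases ha : a ∈ R W
    · rw [if_pos ha, if_pos (hRmono W W' h ha)]
    · rw [if_neg ha]; split_ifs <;> norm_num
  -- the combinatorial heart: `Gt` is increasing
  have hsep_up : ∀ W W' : Set (Sym2 V), W ⊆ W' → sep (R W) → b ∉ R W' → (∀ x ∈ X, x ∉ R W') → sep (R W') := by
    intro W W' h hsW hb hX u hu hua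
    have hRS : ∀ v ∈ openCluster (W' ∩ E) s, v ∉ X ∪ {b} := by
      intro v hv hv'
      rcases hv' with hvX | hvb
      · exact hX v hvX hv
      · exact hb ((Set.mem_singleton_iff.1 hvb) ▸ hv)
    have hsu : (openGraph ({e | e ∈ E ∧ ∀ v ∈ e, v ∉ X ∪ {b}})).Reachable s u := reachable_avoid_of_walk hRS hu
    exact hsW s (mem_openCluster_self _ s) (hsu.trans hua)
  have hGtmono : Monotone Gt := by
    intro W W' h
    simp only [hGt]
    by_cases h1 : (b ∈ R W ∨ (∃ x ∈ X, x ∈ R W) ∨ sep (R W))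
    · rw [if_pos h1]
      have h2 : (b ∈ R W' ∨ (∃ x ∈ X, x ∈ R W') ∨ sep (R W')) := by
        by_cases hb : b ∈ R W'
        · exact Or.inl hb
        by_cases hx : ∃ x ∈ X, x ∈ R W'
        · exact Or.inr (Or.inl hx)
        have hx' : ∀ x ∈ X, x ∉ R W' := fun x hxX hxR => hx ⟨x, hxX, hxR⟩
        rcases h1 with h1 | h1 | h1
        · exact absurd (hRmono W W' h h1) hb
        · obtain ⟨x, hxX, hxR⟩ := h1
          exact absurd (hRmono W W' h hxR) (hx' x hxX)
        · exact Or.inr (Or.inr (hsep_up W W' h h1 hb hx'))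
      rw [if_pos h2]
    · rw [if_neg h1]; split_ifs <;> norm_num
  have hFG : ∀ W, F W * Gt W = F W * G W := by
    intro W
    simp only [hF, hG, hGt]
    by_cases ha : a ∈ R W
    · have hns : ¬ sep (R W) := fun hsW => hsW a ha SimpleGraph.Reachable.rfl
      rw [if_pos ha]
      by_cases h2 : (b ∈ R W ∨ ∃ x ∈ X, x ∈ R W)
      · rw [if_pos h2, if_pos (by rcases h2 with h2 | h2 <;> simp [h2])]
      · rw [if_neg h2, if_neg (fun h => h.elim (fun hb => h2 (Or.inl hb)) (fun h' => h'.elim (fun hx => h2 (Or.inr hx)) hns))]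
    · rw [if_neg ha, zero_mul, zero_mul]
  have key := condCov_ge_majorant_gap w s X hs F G Gt hFmono hGtmono hFG
  -- a.s.: pairs off `E` are closed, so `R (C_s^edge) = C_s`
  have hnull : μ {ω : BondConfig V | ∃ e ∈ (Eᶜ : Set (Sym2 V)).toFinset, e ∈ ω} = 0 :=
    prodBernoulli_setOf_exists_mem_eq_zero w _ fun e he => hE e (by simpa using he)
  have hae : ∀ᵐ ω ∂μ, R (openEdgeCluster ω s) = openCluster ω s := by
    have h1 : ∀ᵐ ω ∂μ, ω ∉ {ω : BondConfig V | ∃ e ∈ (Eᶜ : Set (Sym2 V)).toFinset, e ∈ ω} :=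
      measure_eq_zero_iff_ae_notMem.1 hnull
    filter_upwards [h1] with ω hω
    have hωE : ω ⊆ E := by
      intro e he
      by_contra heE
      exact hω ⟨e, by simpa using heE, he⟩
    have hCE : openEdgeCluster ω s ∩ E = openEdgeCluster ω s :=
      Set.inter_eq_left.2 ((openEdgeCluster_subset ω s).trans hωE)
    simp only [hR, hCE, openCluster_openEdgeCluster]
  -- identification of the four integrals with measures of events
  have hint : ∀ (f : BondConfig V → ℝ) (A : Set (BondConfig V)),
      (∀ ω, R (openEdgeCluster ω s) = openCluster ω s → f ω = if ω ∈ A then (1 : ℝ) else 0) →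
      ∫ ω in D, f ω ∂μ = μ.real (D ∩ A) := by
    intro f A hA
    have h1 : ∫ ω in D, f ω ∂μ = ∫ ω in D, A.indicator (fun _ => (1 : ℝ)) ω ∂μ := by
      refine setIntegral_congr_ae (hmeas D) ?_
      filter_upwards [hae] with ω hω _
      rw [hA ω hω, Set.indicator_apply]
    rw [h1, integral_indicator (hmeas A), Measure.restrict_restrict (hmeas A), integral_const, smul_eq_mul, mul_one,
      Set.inter_comm, measureReal_restrict_apply_univ]
  have hIF : ∫ ω in D, F (openEdgeCluster ω s) ∂μ = μ.real (D ∩ openConn s a) :=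
    hint (fun ω => F (openEdgeCluster ω s)) (openConn s a) fun ω hω => by
      simp only [hF, hω]
      exact if_congr Iff.rfl rfl rfl
  -- on `D` the cluster misses `X`, so `G(C_s) = 1{s ↔ b}` there
  have hDX : ∀ ω ∈ D, ∀ x ∈ X, x ∉ openCluster ω s := fun ω hω x hx hxC => hω x hx hxC
  have hIG : ∫ ω in D, G (openEdgeCluster ω s) ∂μ = μ.real (D ∩ openConn s b) := by
    have h1 := hint (fun ω => G (openEdgeCluster ω s)) {ω | b ∈ openCluster ω s ∨ ∃ x ∈ X, x ∈ openCluster ω s}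
      fun ω hω => by
        simp only [hG, hω]
        by_cases h : (b ∈ openCluster ω s ∨ ∃ x ∈ X, x ∈ openCluster ω s)
        · rw [if_pos h, if_pos (show ω ∈ {ω | b ∈ openCluster ω s ∨ ∃ x ∈ X, x ∈ openCluster ω s} from h)]
        · rw [if_neg h, if_neg (show ω ∉ {ω | b ∈ openCluster ω s ∨ ∃ x ∈ X, x ∈ openCluster ω s} from h)]
    have h2 : D ∩ {ω | b ∈ openCluster ω s ∨ ∃ x ∈ X, x ∈ openCluster ω s} = D ∩ openConn s b := by
      ext ω
      simp only [Set.mem_inter_iff, Set.mem_setOf_eq, openConn]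
      constructor
      · rintro ⟨hω, h | ⟨x, hx, hxC⟩⟩
        · exact ⟨hω, h⟩
        · exact absurd hxC (hDX ω hω x hx)
      · rintro ⟨hω, h⟩
        exact ⟨hω, Or.inl h⟩
    rw [h1, h2]
  have hIGt : ∫ ω in D, Gt (openEdgeCluster ω s) ∂μ =
      μ.real (D ∩ openConn s b) + μ.real (D ∩ {ω | b ∉ openCluster ω s ∧ sep (openCluster ω s)}) := by
    have h1 := hint (fun ω => Gt (openEdgeCluster ω s))
      {ω | b ∈ openCluster ω s ∨ (∃ x ∈ X, x ∈ openCluster ω s) ∨ sep (openCluster ω s)} fun ω hω => by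
        simp only [hGt, hω]
        by_cases h : (b ∈ openCluster ω s ∨ (∃ x ∈ X, x ∈ openCluster ω s) ∨ sep (openCluster ω s))
        · rw [if_pos h, if_pos (show ω ∈ {ω | b ∈ openCluster ω s ∨ (∃ x ∈ X, x ∈ openCluster ω s) ∨
            sep (openCluster ω s)} from h)]
        · rw [if_neg h, if_neg (show ω ∉ {ω | b ∈ openCluster ω s ∨ (∃ x ∈ X, x ∈ openCluster ω s) ∨
            sep (openCluster ω s)} from h)]
    have h2 : D ∩ {ω | b ∈ openCluster ω s ∨ (∃ x ∈ X, x ∈ openCluster ω s) ∨ sep (openCluster ω s)} =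
        (D ∩ openConn s b) ∪ (D ∩ {ω | b ∉ openCluster ω s ∧ sep (openCluster ω s)}) := by
      ext ω
      simp only [Set.mem_inter_iff, Set.mem_setOf_eq, Set.mem_union, openConn]
      constructor
      · rintro ⟨hω, h | ⟨x, hx, hxC⟩ | h⟩
        · exact Or.inl ⟨hω, h⟩
        · exact absurd hxC (hDX ω hω x hx)
        · by_cases hb : b ∈ openCluster ω s
          · exact Or.inl ⟨hω, hb⟩
          · exact Or.inr ⟨hω, hb, h⟩
      · rintro (⟨hω, h⟩ | ⟨hω, hb, h⟩)
        · exact ⟨hω, Or.inl h⟩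
        · exact ⟨hω, Or.inr (Or.inr h)⟩
    have hdisj : Disjoint (D ∩ openConn s b) (D ∩ {ω | b ∉ openCluster ω s ∧ sep (openCluster ω s)}) := by
      rw [Set.disjoint_left]
      rintro ω ⟨_, hb⟩ ⟨_, hb', _⟩
      exact hb' hb
    rw [h1, h2, measureReal_union hdisj (hmeas _)]
  have hIFG : ∫ ω in D, F (openEdgeCluster ω s) * G (openEdgeCluster ω s) ∂μ = μ.real (D ∩ openConn s a ∩ openConn s b) := by
    have h1 := hint (fun ω => F (openEdgeCluster ω s) * G (openEdgeCluster ω s))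
      {ω | a ∈ openCluster ω s ∧ (b ∈ openCluster ω s ∨ ∃ x ∈ X, x ∈ openCluster ω s)} fun ω hω => by
        simp only [hF, hG, hω, Set.mem_setOf_eq]
        by_cases ha : a ∈ openCluster ω s
        · by_cases hb : (b ∈ openCluster ω s ∨ ∃ x ∈ X, x ∈ openCluster ω s)
          · rw [if_pos ha, if_pos hb, one_mul]
            exact (if_pos (show a ∈ openCluster ω s ∧ (b ∈ openCluster ω s ∨ ∃ x ∈ X, x ∈ openCluster ω s) from ⟨ha, hb⟩)).symm
          · rw [if_pos ha, if_neg hb, one_mul]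
            exact (if_neg (show ¬ (a ∈ openCluster ω s ∧ (b ∈ openCluster ω s ∨ ∃ x ∈ X, x ∈ openCluster ω s)) from
              fun h => hb h.2)).symm
        · rw [if_neg ha, zero_mul]
          exact (if_neg (show ¬ (a ∈ openCluster ω s ∧ (b ∈ openCluster ω s ∨ ∃ x ∈ X, x ∈ openCluster ω s)) from
            fun h => ha h.1)).symm
    have h2 : D ∩ {ω | a ∈ openCluster ω s ∧ (b ∈ openCluster ω s ∨ ∃ x ∈ X, x ∈ openCluster ω s)} =
        D ∩ openConn s a ∩ openConn s b := by
      ext ω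
      simp only [Set.mem_inter_iff, Set.mem_setOf_eq, openConn]
      constructor
      · rintro ⟨hω, ha, h | ⟨x, hx, hxC⟩⟩
        · exact ⟨⟨hω, ha⟩, h⟩
        · exact absurd hxC (hDX ω hω x hx)
      · rintro ⟨⟨hω, ha⟩, h⟩
        exact ⟨hω, ha, Or.inl h⟩
    rw [h1, h2]
  rw [hIF, hIG, hIGt, hIFG] at key
  have hsepev : D ∩ {ω | b ∉ openCluster ω s ∧ sep (openCluster ω s)} =
      D ∩ {ω | b ∉ openCluster ω s ∧ ∀ u ∈ openCluster ω s, ¬ (openGraph ({e | e ∈ E ∧ ∀ v ∈ e, v ∉ X ∪ {b}})).Reachable u a} := by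
    rfl
  rw [hsepev] at key
  linarith [key]

end QuantBHK

end Summit.CriticalPhenomena.PercolationContinuityZ3.Theorems
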